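import Literature.NumberTheory.Sieve.CFSemigroupLimitSetEq
import Literature.NumberTheory.Sieve.CFSemigroupAperiodic
import Literature.NumberTheory.Sieve.CFSemigroupEigenfunctionUnique
import HarnessLib

/-!
# Porosity of the continued-fraction Cantor set `E_A` (toward Magee–Oh–Winter Prop. 26)

Support file (all results proved) for the programme of proving [MageeOhWinter2019, Thm. 4 (2)]
(Dolgopyat bounds) for `Γ_A`. The triadic partitions of [MageeOhWinter2019, Prop. 26] (after Naud) require
intervals at every scale `ε` whose endpoints stay at distance `≥ A₂ ε` from the Cantor set `K`; this rests
on the **porosity** of `K = E_A`: every ball `B(x, r)`, `x ∈ E_A`, `0 < r ≤ 1`, contains an open interval of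
length `≥ c r` missing `E_A`. We prove it from the self-similar structure:

* `cfCantorSet_subset_Icc_bounds`: `E_A ⊆ [α, β]` with `α = 1/(a_max + 1)`, `β = (a_max+1)/(a_max+2) < 1`;
* `cfMoeb_cfWord_sub`: `M_n u - M_n v = (-1)^n (u - v)/(denom_n(u) denom_n(v))`, whence the two-sided
  bounds `|u-v|/(4 q_n²) ≤ |M_n u - M_n v| ≤ |u-v|/q_n²` on `[0,1]` (`M_n = cfWord d n`);
* `cfMoeb_cfWord_not_mem`: **the gaps** `M_n((β, 1)) ∩ E_A = ∅` for every digit sequence `d ∈ A^ℕ`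
  (first-digit induction: distinct first digits give cylinders `[1/(a+1), 1/a]` meeting only at
  reciprocals of integers, which are not of the form `M_n(t)`, `t ∈ (0,1)`);
* `cfCantorSet_porous`: **porosity** with the explicit constant `c = (1 - β)/(16 (a_max+1)²)`.

## References

* [MageeOhWinter2019] M. Magee, H. Oh, D. Winter, J. reine angew. Math. 753 (2019) 89–135, §4.5 Prop. 26
  (after F. Naud, Ann. Sci. ÉNS 38 (2005), §5.3).
-/

noncomputable section

open Set

namespace Literature.NumberTheory.Sieve

variable {A : Finset ℕ} (hA : ∀ a ∈ A, 1 ≤ a)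

/-! ### Words of a digit sequence as `cfMat` words -/

/-- `cfWord d n = cfMat (d|n)`. [folklore] -/
theorem cfWord_eq_cfMat (d : ℕ → ℕ) (n : ℕ) : cfWord d n = cfMat (fun i : Fin n => d i) := by
  unfold cfMat
  exact cfWord_congr fun i hi => by rw [cfExt_of_lt _ hi]

/-- `q(d|n) = q_n(d)`. [folklore] -/
theorem cfQ_restrict (d : ℕ → ℕ) (n : ℕ) : cfQ (fun i : Fin n => d i) = cfDen d n := by
  rw [cfQ_eq, ← cfWord_eq_cfMat]; rfl

section Word

variable {d : ℕ → ℕ} (hd : ∀ i, 1 ≤ d i)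
include hd

/-- The denominator of `M_n` on `[0,1]` lies in `[q_n, 2 q_n]` and `q_n ≥ 1`. [folklore] -/
theorem cfDenom_cfWord_bounds (n : ℕ) {x : ℝ} (hx : x ∈ Icc (0 : ℝ) 1) :
    (cfDen d n : ℝ) ≤ cfDenom (cfWord d n) x ∧ cfDenom (cfWord d n) x ≤ 2 * (cfDen d n : ℝ) ∧ (1 : ℝ) ≤ (cfDen d n : ℝ) := by
  have hw : ∀ i : Fin n, 1 ≤ (fun i : Fin n => d i) i := fun i => hd i
  have h := cfDenom_cfMat_mem hw hx
  rw [← cfWord_eq_cfMat, cfQ_restrict] at h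
  exact ⟨h.1, h.2, by exact_mod_cast one_le_cfDen hd n⟩

/-- `denom_n(x) > 0` on `[0,1]`. [folklore] -/
theorem cfDenom_cfWord_pos (n : ℕ) {x : ℝ} (hx : x ∈ Icc (0 : ℝ) 1) : 0 < cfDenom (cfWord d n) x := by
  have h := cfDenom_cfWord_bounds hd n hx
  linarith [h.1, h.2.2]

/-- `M_n` maps `[0,1]` into `[0,1]`. [folklore] -/
theorem cfMoeb_cfWord_mem (n : ℕ) {x : ℝ} (hx : x ∈ Icc (0 : ℝ) 1) : cfMoeb (cfWord d n) x ∈ Icc (0 : ℝ) 1 := by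
  rw [cfWord_eq_cfMat]
  exact cfMoeb_cfMat_mem (fun i => hd i) hx

/-- **The difference formula** `M_n u - M_n v = (-1)^n (u - v) / (denom_n(u) denom_n(v))`. [folklore] -/
theorem cfMoeb_cfWord_sub (n : ℕ) {u v : ℝ} (hu : u ∈ Icc (0 : ℝ) 1) (hv : v ∈ Icc (0 : ℝ) 1) :
    cfMoeb (cfWord d n) u - cfMoeb (cfWord d n) v =
      (-1) ^ n * (u - v) / (cfDenom (cfWord d n) u * cfDenom (cfWord d n) v) := by
  have hdu := cfDenom_cfWord_pos hd n hu
  have hdv := cfDenom_cfWord_pos hd n hv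
  have hdet : ((cfWord d n) 0 0 : ℝ) * (cfWord d n) 1 1 - (cfWord d n) 0 1 * (cfWord d n) 1 0 = (-1) ^ n := by
    have h := det_cfWord d n
    rw [Matrix.det_fin_two] at h
    exact_mod_cast h
  simp only [cfMoeb, cfDenom] at hdu hdv ⊢
  rw [div_sub_div _ _ hdu.ne' hdv.ne']
  congr 1
  linear_combination (u - v) * hdet

/-- **Two-sided contraction bounds:** `|u-v|/(4 q_n²) ≤ |M_n u - M_n v| ≤ |u-v|/q_n²` on `[0,1]`. [folklore] -/
theorem abs_cfMoeb_cfWord_sub_bounds (n : ℕ) {u v : ℝ} (hu : u ∈ Icc (0 : ℝ) 1) (hv : v ∈ Icc (0 : ℝ) 1) :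
    |u - v| / (4 * (cfDen d n : ℝ) ^ 2) ≤ |cfMoeb (cfWord d n) u - cfMoeb (cfWord d n) v| ∧
      |cfMoeb (cfWord d n) u - cfMoeb (cfWord d n) v| ≤ |u - v| / (cfDen d n : ℝ) ^ 2 := by
  obtain ⟨hqu, hu2, hq1⟩ := cfDenom_cfWord_bounds hd n hu
  obtain ⟨hqv, hv2, -⟩ := cfDenom_cfWord_bounds hd n hv
  have hdu := cfDenom_cfWord_pos hd n hu
  have hdv := cfDenom_cfWord_pos hd n hv
  rw [cfMoeb_cfWord_sub hd n hu hv, abs_div, abs_mul, abs_pow, abs_neg, abs_one, one_pow, one_mul,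
    abs_of_pos (mul_pos hdu hdv)]
  have huv := abs_nonneg (u - v)
  constructor
  · exact div_le_div_of_nonneg_left huv (mul_pos hdu hdv) (by nlinarith)
  · exact div_le_div_of_nonneg_left huv (by positivity) (by nlinarith)

/-- `M_n` is continuous on `[0,1]`. [folklore] -/
theorem continuousOn_cfMoeb_cfWord (n : ℕ) : ContinuousOn (cfMoeb (cfWord d n)) (Icc (0 : ℝ) 1) := by
  unfold cfMoeb
  refine ContinuousOn.div (by fun_prop) (by fun_prop) fun x hx => ?_
  exact (cfDenom_cfWord_pos hd n hx).ne'

/-- `M_n` maps the OPEN interval `(0,1)` into `(0,1)`. [folklore] -/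
theorem cfMoeb_cfWord_mem_Ioo (n : ℕ) {x : ℝ} (hx : x ∈ Ioo (0 : ℝ) 1) : cfMoeb (cfWord d n) x ∈ Ioo (0 : ℝ) 1 := by
  induction n generalizing d x with
  | zero => simpa [cfMoeb] using hx
  | succ n ih =>
    -- `M_{n+1}(d) = g_{d 0} ∘ M_n(shift d)`
    have hd' : ∀ i, 1 ≤ (fun i => d (i + 1)) i := fun i => hd (i + 1)
    have hsplit : cfWord d (n + 1) = cfGen (d 0) * cfWord (fun i => d (i + 1)) n := by
      have h := cfWord_add d 1 n
      rwa [show cfWord d 1 = cfGen (d 0) by rw [cfWord_succ, cfWord_zero, one_mul]] at h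
    have hy := ih hd' hx
    have hy' : cfMoeb (cfWord (fun i => d (i + 1)) n) x ∈ Icc (0 : ℝ) 1 := Ioo_subset_Icc_self hy
    have hden1 : cfDenom (cfWord (fun i => d (i + 1)) n) x ≠ 0 := (cfDenom_cfWord_pos hd' n (Ioo_subset_Icc_self hx)).ne'
    have ha1 : (1 : ℝ) ≤ d 0 := by exact_mod_cast hd 0
    have hden2 : cfDenom (cfGen (d 0)) (cfMoeb (cfWord (fun i => d (i + 1)) n) x) ≠ 0 := by
      rw [cfDenom_cfGen]; linarith [hy.1]
    rw [hsplit, cfMoeb_mul _ _ hden1 hden2, cfMoeb_cfGen]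
    set y := cfMoeb (cfWord (fun i => d (i + 1)) n) x
    constructor
    · exact div_pos one_pos (by linarith [hy.1])
    · rw [div_lt_one (by linarith [hy.1])]; linarith [hy.1]

end Word

/-! ### `E_A ⊆ [α, β]` -/

/-- The lower bound `α_A = 1/(a_max + 1)` for `E_A`. [folklore] -/
def cfAlpha (A : Finset ℕ) (hne : A.Nonempty) : ℝ := 1 / ((A.max' hne : ℝ) + 1)

/-- The upper bound `β_A = (a_max + 1)/(a_max + 2) < 1` for `E_A`. [folklore] -/
def cfBeta (A : Finset ℕ) (hne : A.Nonempty) : ℝ := ((A.max' hne : ℝ) + 1) / ((A.max' hne : ℝ) + 2)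

/-- `β_A < 1`. [folklore] -/
theorem cfBeta_lt_one (hne : A.Nonempty) : cfBeta A hne < 1 := by
  unfold cfBeta; rw [div_lt_one (by positivity)]; linarith

/-- `β_A > 0`. [folklore] -/
theorem cfBeta_pos (hne : A.Nonempty) : 0 < cfBeta A hne := by unfold cfBeta; positivity

/-- `α_A > 0`. [folklore] -/
theorem cfAlpha_pos (hne : A.Nonempty) : 0 < cfAlpha A hne := by unfold cfAlpha; positivity

include hA in
/-- `[0; d] = 1/(d₀ + [0; shift d])` with `[0; shift d] ∈ [0,1]`, so `[0; d] ≥ 1/(a_max+1)`. [folklore] -/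
theorem cfAlpha_le_cfValue (hne : A.Nonempty) {d : ℕ → ℕ} (hdA : ∀ i, d i ∈ A) : cfAlpha A hne ≤ cfValue d := by
  have hd : ∀ i, 1 ≤ d i := fun i => hA _ (hdA i)
  have h1 := cfValue_eq_cfMoeb_cfWord hd 1
  rw [show cfWord d 1 = cfGen (d 0) by rw [cfWord_succ, cfWord_zero, one_mul], cfMoeb_cfGen] at h1
  have ht := cfValue_mem_Icc (d := fun i => d (i + 1)) fun i => hd (i + 1)
  have hmax : (d 0 : ℝ) ≤ A.max' hne := by exact_mod_cast A.le_max' _ (hdA 0)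
  rw [h1, cfAlpha]
  exact div_le_div_of_nonneg_left zero_le_one (by linarith [ht.1, (show (1:ℝ) ≤ d 0 by exact_mod_cast hd 0)])
    (by linarith [ht.2])

include hA in
/-- `[0; d] ≤ β_A = (a_max+1)/(a_max+2)` for `d ∈ A^ℕ`. [folklore] -/
theorem cfValue_le_cfBeta (hne : A.Nonempty) {d : ℕ → ℕ} (hdA : ∀ i, d i ∈ A) : cfValue d ≤ cfBeta A hne := by
  have hd : ∀ i, 1 ≤ d i := fun i => hA _ (hdA i)
  have h1 := cfValue_eq_cfMoeb_cfWord hd 1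
  rw [show cfWord d 1 = cfGen (d 0) by rw [cfWord_succ, cfWord_zero, one_mul], cfMoeb_cfGen] at h1
  have ht : cfAlpha A hne ≤ cfValue (fun i => d (i + 1)) := cfAlpha_le_cfValue hA hne fun i => hdA (i + 1)
  have hα := cfAlpha_pos (A := A) hne
  have hd0 : (1 : ℝ) ≤ d 0 := by exact_mod_cast hd 0
  rw [h1]
  calc 1 / (cfValue (fun i => d (i + 1)) + d 0) ≤ 1 / (cfAlpha A hne + 1) :=
        div_le_div_of_nonneg_left zero_le_one (by linarith) (by linarith)
    _ = cfBeta A hne := by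
        unfold cfAlpha cfBeta
        have : (0 : ℝ) < (A.max' hne : ℝ) + 1 := by positivity
        field_simp
        ring

include hA in
/-- **`E_A ⊆ [α_A, β_A]`.** [folklore] -/
theorem cfCantorSet_subset_Icc_bounds (hne : A.Nonempty) : cfCantorSet A ⊆ Icc (cfAlpha A hne) (cfBeta A hne) := by
  rintro _ ⟨d, hdA, rfl⟩
  exact ⟨cfAlpha_le_cfValue hA hne hdA, cfValue_le_cfBeta hA hne hdA⟩

/-! ### The gaps `M_n((β, 1))` miss `E_A` -/

/-- Reciprocals of integers: if `1/(y + a) = 1/(y' + a')` with `y, y' ∈ [0,1]`, naturals `a ≠ a'`, then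
`y ∈ {0, 1}`. [folklore] -/
theorem eq_zero_or_one_of_inv_eq {a a' : ℕ} (hne : a ≠ a') {y y' : ℝ} (hy : y ∈ Icc (0 : ℝ) 1) (hy' : y' ∈ Icc (0 : ℝ) 1)
    (h : 1 / (y + a) = 1 / (y' + a')) : y = 0 ∨ y = 1 := by
  have heq : y + a = y' + a' := by
    have := congrArg (fun t : ℝ => t⁻¹) h
    simpa using this
  -- `a - a' = y' - y ∈ (-1, 1) ∪ {±1}` and is an integer
  rcases lt_trichotomy a a' with hlt | heq' | hgt
  · -- `a < a'`: `y = y' + (a' - a) ≥ y' + 1 ≥ 1`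
    have h1 : (a : ℝ) + 1 ≤ a' := by exact_mod_cast hlt
    right; linarith [hy.2, hy'.1]
  · exact absurd heq' hne
  · have h1 : (a' : ℝ) + 1 ≤ a := by exact_mod_cast hgt
    left; linarith [hy.1, hy'.2]

include hA in
/-- **The gap lemma:** for `d ∈ A^ℕ`, `n ∈ ℕ` and `t ∈ (β_A, 1)`, the point `M_n(d) t` is not in `E_A`.
[cite: MageeOhWinter2019, Prop. 26 (4)] -/
theorem cfMoeb_cfWord_not_mem (hne : A.Nonempty) :
    ∀ (n : ℕ) {d : ℕ → ℕ}, (∀ i, d i ∈ A) → ∀ {t : ℝ}, t ∈ Ioo (cfBeta A hne) 1 →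
      cfMoeb (cfWord d n) t ∉ cfCantorSet A := by
  intro n
  induction n with
  | zero =>
    intro d _ t ht hmem
    have h := (cfCantorSet_subset_Icc_bounds hA hne hmem).2
    simp [cfMoeb] at h
    linarith [ht.1]
  | succ n ih =>
    intro d hdA t ht hmem
    obtain ⟨e, heA, he⟩ := hmem
    have hd : ∀ i, 1 ≤ d i := fun i => hA _ (hdA i)
    have he1 : ∀ i, 1 ≤ e i := fun i => hA _ (heA i)
    have hd' : ∀ i, 1 ≤ (fun i => d (i + 1)) i := fun i => hd (i + 1)
    have hβ := cfBeta_pos (A := A) hne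
    have htI : t ∈ Ioo (0 : ℝ) 1 := ⟨hβ.trans ht.1, ht.2⟩
    -- `M_{n+1}(d) t = g_{d 0}(y)`, `y = M_n(shift d) t ∈ (0,1)`
    have hsplit : cfWord d (n + 1) = cfGen (d 0) * cfWord (fun i => d (i + 1)) n := by
      have h := cfWord_add d 1 n
      rwa [show cfWord d 1 = cfGen (d 0) by rw [cfWord_succ, cfWord_zero, one_mul]] at h
    have hy := cfMoeb_cfWord_mem_Ioo hd' n htI
    set y := cfMoeb (cfWord (fun i => d (i + 1)) n) t with hydef
    have hden1 : cfDenom (cfWord (fun i => d (i + 1)) n) t ≠ 0 := (cfDenom_cfWord_pos hd' n (Ioo_subset_Icc_self htI)).ne'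
    have hd0 : (1 : ℝ) ≤ d 0 := by exact_mod_cast hd 0
    have hden2 : cfDenom (cfGen (d 0)) y ≠ 0 := by rw [cfDenom_cfGen]; linarith [hy.1]
    have hlhs : cfMoeb (cfWord d (n + 1)) t = 1 / (y + d 0) := by
      rw [hsplit, cfMoeb_mul _ _ hden1 hden2, cfMoeb_cfGen]
    -- `cfValue e = g_{e 0}(y')`, `y' = [0; shift e] ∈ E_A`
    have he' := cfValue_eq_cfMoeb_cfWord he1 1
    rw [show cfWord e 1 = cfGen (e 0) by rw [cfWord_succ, cfWord_zero, one_mul], cfMoeb_cfGen] at he'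
    set y' := cfValue (fun i => e (i + 1)) with hy'def
    have hy'I : y' ∈ Icc (0 : ℝ) 1 := cfValue_mem_Icc fun i => he1 (i + 1)
    have he0 : (1 : ℝ) ≤ e 0 := by exact_mod_cast he1 0
    have hEq : 1 / (y + d 0) = 1 / (y' + e 0) := by rw [← hlhs, he, he']
    by_cases hde : d 0 = e 0
    · -- same first digit: cancel and apply the induction hypothesis to the tails
      have hyy : y = y' := by
        have := congrArg (fun s : ℝ => s⁻¹) hEq
        simp only [one_div, inv_inv] at this
        rw [hde] at this; linarith
      have hmem' : cfMoeb (cfWord (fun i => d (i + 1)) n) t ∈ cfCantorSet A :=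
        ⟨fun i => e (i + 1), fun i => heA (i + 1), by rw [← hydef, hyy]⟩
      exact ih (fun i => hdA (i + 1)) ht hmem'
    · -- distinct first digits: `y ∈ {0,1}`, impossible for `y ∈ (0,1)`
      rcases eq_zero_or_one_of_inv_eq hde (Ioo_subset_Icc_self hy) hy'I hEq with h0 | h1
      · linarith [hy.1]
      · linarith [hy.2]

/-! ### Porosity -/

include hA in
/-- **Porosity of `E_A`:** with `c = (1-β_A)/(16 (a_max+1)²)`, for every `x ∈ E_A` and `0 < r ≤ 1` there is an
open interval `(p - ρ, p + ρ)` with `ρ ≥ c r`, contained in `(x - r, x + r)`, and disjoint from `E_A`.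
[cite: MageeOhWinter2019, Prop. 26] -/
theorem cfCantorSet_porous (hne : A.Nonempty) :
    ∃ c : ℝ, 0 < c ∧ ∀ x ∈ cfCantorSet A, ∀ r : ℝ, 0 < r → r ≤ 1 →
      ∃ p ρ : ℝ, c * r ≤ ρ ∧ Ioo (p - ρ) (p + ρ) ⊆ Ioo (x - r) (x + r) ∧ Ioo (p - ρ) (p + ρ) ∩ cfCantorSet A = ∅ := by
  set amax : ℝ := (A.max' hne : ℝ) with hamax
  set β := cfBeta A hne with hβdef
  have hβ1 : β < 1 := cfBeta_lt_one hne
  have hβ0 : 0 < β := cfBeta_pos hne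
  have hamax0 : 0 ≤ amax := Nat.cast_nonneg _
  refine ⟨(1 - β) / (16 * (amax + 1) ^ 2), by positivity, ?_⟩
  rintro x ⟨d, hdA, rfl⟩ r hr hr1
  have hd : ∀ i, 1 ≤ d i := fun i => hA _ (hdA i)
  have hB : ∀ i, d i ≤ A.max' hne := fun i => A.le_max' _ (hdA i)
  -- choose `m` minimal with `q_{m+1}² > 2/r`; then `q_m² ≤ 2/r`
  have hex : ∃ k : ℕ, 2 / r < ((cfDen d (k + 1) : ℝ)) ^ 2 := by
    obtain ⟨k, hk⟩ := exists_nat_gt (2 / r)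
    refine ⟨k, hk.trans_le ?_⟩
    have h1 : ((k + 1 : ℕ) : ℝ) ≤ (cfDen d (k + 1) : ℝ) := by exact_mod_cast le_cfDen hd (k + 1)
    have h2 : (1 : ℝ) ≤ (cfDen d (k + 1) : ℝ) := by exact_mod_cast one_le_cfDen hd (k + 1)
    push_cast at h1
    nlinarith
  classical
  set m := Nat.find hex with hmdef
  have hn : 2 / r < ((cfDen d (m + 1) : ℝ)) ^ 2 := Nat.find_spec hex
  have hm : ((cfDen d m : ℝ)) ^ 2 ≤ 2 / r := by
    rcases Nat.eq_zero_or_pos m with h0 | hpos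
    · have hq0 : (cfDen d m : ℝ) = 1 := by rw [h0]; simp [cfDen]
      rw [hq0, one_pow, le_div_iff₀ hr]; linarith
    · obtain ⟨k, hk⟩ := Nat.exists_eq_succ_of_ne_zero hpos.ne'
      have hmin : ¬ 2 / r < ((cfDen d (k + 1) : ℝ)) ^ 2 := Nat.find_min hex (by rw [← hmdef, hk]; exact Nat.lt_succ_self k)
      rw [hk]
      exact not_lt.1 hmin
  -- `q_{m+1} ≤ (amax+1) q_m`, so `q_{m+1}² ≤ (amax+1)² · 2/r`
  have hqsucc : (cfDen d (m + 1) : ℝ) ≤ (amax + 1) * (cfDen d m : ℝ) := by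
    have := cfDen_succ_le hd hB m; rw [hamax]; exact_mod_cast this
  have hqm0 : (0 : ℝ) ≤ (cfDen d m : ℝ) := by
    have : (1 : ℝ) ≤ (cfDen d m : ℝ) := by exact_mod_cast one_le_cfDen hd m
    linarith
  have hq10 : (1 : ℝ) ≤ (cfDen d (m + 1) : ℝ) := by exact_mod_cast one_le_cfDen hd (m + 1)
  have hq0 : (0 : ℝ) < ((cfDen d (m + 1) : ℝ)) ^ 2 := pow_pos (by linarith) 2
  have hq2 : ((cfDen d (m + 1) : ℝ)) ^ 2 ≤ (amax + 1) ^ 2 * (2 / r) := by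
    calc ((cfDen d (m + 1) : ℝ)) ^ 2 ≤ ((amax + 1) * (cfDen d m : ℝ)) ^ 2 := pow_le_pow_left₀ (by linarith) hqsucc 2
      _ = (amax + 1) ^ 2 * ((cfDen d m : ℝ)) ^ 2 := by ring
      _ ≤ (amax + 1) ^ 2 * (2 / r) := by gcongr
  -- the gap: endpoints `M β`, `M 1`
  set M := cfWord d (m + 1) with hM
  have hβI : β ∈ Icc (0 : ℝ) 1 := ⟨hβ0.le, hβ1.le⟩
  have h1I : (1 : ℝ) ∈ Icc (0 : ℝ) 1 := ⟨zero_le_one, le_rfl⟩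
  obtain ⟨hlow, -⟩ := abs_cfMoeb_cfWord_sub_bounds hd (m + 1) h1I hβI
  set a₁ := cfMoeb M 1 with ha₁
  set b₁ := cfMoeb M β with hb₁
  set p := (a₁ + b₁) / 2 with hp
  set ρ := |a₁ - b₁| / 2 with hρ
  have hgap : |1 - β| / (4 * ((cfDen d (m + 1) : ℝ)) ^ 2) ≤ |a₁ - b₁| := hlow
  refine ⟨p, ρ, ?_, ?_, ?_⟩
  · -- `ρ ≥ c r`
    rw [hρ]
    have h1 : (1 - β) / (4 * ((amax + 1) ^ 2 * (2 / r))) ≤ |1 - β| / (4 * ((cfDen d (m + 1) : ℝ)) ^ 2) := by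
      rw [abs_of_pos (by linarith)]
      exact div_le_div_of_nonneg_left (by linarith) (by positivity) (by nlinarith)
    have e : (1 - β) / (4 * ((amax + 1) ^ 2 * (2 / r))) = 2 * ((1 - β) / (16 * (amax + 1) ^ 2) * r) := by
      field_simp; ring
    linarith
  · -- the interval lies in the cylinder `M([0,1]) ∋ x`, of diameter `≤ 1/q² < r/2 < r`
    have hxM : cfValue d = cfMoeb M (cfValue fun i => d (i + (m + 1))) := cfValue_eq_cfMoeb_cfWord hd (m + 1)
    have htail : cfValue (fun i => d (i + (m + 1))) ∈ Icc (0 : ℝ) 1 := cfValue_mem_Icc fun i => hd _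
    have hdiam : ∀ u ∈ Icc (0 : ℝ) 1, |cfMoeb M u - cfValue d| < r / 2 := fun u hu => by
      rw [hxM]
      refine ((abs_cfMoeb_cfWord_sub_bounds hd (m + 1) hu htail).2).trans_lt ?_
      have huv : |u - cfValue (fun i => d (i + (m + 1)))| ≤ 1 := by
        rw [abs_le]; constructor <;> linarith [hu.1, hu.2, htail.1, htail.2]
      calc |u - cfValue (fun i => d (i + (m + 1)))| / ((cfDen d (m + 1) : ℝ)) ^ 2 ≤ 1 / ((cfDen d (m + 1) : ℝ)) ^ 2 :=
            div_le_div_of_nonneg_right huv hq0.le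
        _ < r / 2 := by rw [div_lt_iff₀ hq0, ← div_lt_iff₀' (by positivity)]; simpa [div_div] using hn
    have ha := hdiam 1 h1I
    have hb := hdiam β hβI
    rw [← ha₁] at ha; rw [← hb₁] at hb
    intro z hz
    simp only [mem_Ioo, hp, hρ] at hz ⊢
    rw [abs_lt] at ha hb
    rcases le_total a₁ b₁ with hab | hab
    · rw [abs_of_nonpos (by linarith)] at hz; constructor <;> linarith [hz.1, hz.2]
    · rw [abs_of_nonneg (by linarith)] at hz; constructor <;> linarith [hz.1, hz.2]
  · -- the open interval between `M β` and `M 1` misses `E_A`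
    refine eq_empty_iff_forall_notMem.2 fun z ⟨hz, hzE⟩ => ?_
    -- `z = M t` for some `t ∈ (β, 1)` by the intermediate value theorem
    have hcont : ContinuousOn (cfMoeb M) (Icc β 1) := (continuousOn_cfMoeb_cfWord hd (m + 1)).mono (Icc_subset_Icc hβ0.le le_rfl)
    have hzI : z ∈ Ioo (min a₁ b₁) (max a₁ b₁) := by
      simp only [mem_Ioo, hp, hρ] at hz
      rcases le_total a₁ b₁ with hab | hab
      · rw [abs_of_nonpos (by linarith)] at hz
        rw [min_eq_left hab, max_eq_right hab]; constructor <;> linarith [hz.1, hz.2]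
      · rw [abs_of_nonneg (by linarith)] at hz
        rw [min_eq_right hab, max_eq_left hab]; constructor <;> linarith [hz.1, hz.2]
    have hsurj : z ∈ cfMoeb M '' Icc β 1 := by
      have h1 := intermediate_value_Icc hβ1.le hcont   -- Icc (M β) (M 1) ⊆ image
      have h2 := intermediate_value_Icc' hβ1.le hcont  -- Icc (M 1) (M β) ⊆ image
      rcases le_total a₁ b₁ with hab | hab
      · exact h2 ⟨by rw [min_eq_left hab] at hzI; exact hzI.1.le, by rw [max_eq_right hab] at hzI; exact hzI.2.le⟩
      · exact h1 ⟨by rw [min_eq_right hab] at hzI; exact hzI.1.le, by rw [max_eq_left hab] at hzI; exact hzI.2.le⟩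
    obtain ⟨t, htI, rfl⟩ := hsurj
    have hnotb : cfMoeb M t ≠ b₁ := fun h => by
      rw [h] at hzI
      rcases le_total a₁ b₁ with hab | hab
      · rw [max_eq_right hab] at hzI; exact lt_irrefl _ hzI.2
      · rw [min_eq_right hab] at hzI; exact lt_irrefl _ hzI.1
    have hnota : cfMoeb M t ≠ a₁ := fun h => by
      rw [h] at hzI
      rcases le_total a₁ b₁ with hab | hab
      · rw [min_eq_left hab] at hzI; exact lt_irrefl _ hzI.1
      · rw [max_eq_left hab] at hzI; exact lt_irrefl _ hzI.2
    have htβ : t ≠ β := fun h => hnotb (by rw [h])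
    have ht1 : t ≠ 1 := fun h => hnota (by rw [h])
    have htIoo : t ∈ Ioo β 1 := ⟨lt_of_le_of_ne htI.1 (Ne.symm htβ), lt_of_le_of_ne htI.2 ht1⟩
    exact cfMoeb_cfWord_not_mem hA hne (m + 1) hdA htIoo hzE

end Literature.NumberTheory.Sieve
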